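import Summits.CriticalPhenomena.PercolationContinuityZ3.Theorems.Transplant.PlanarSkeletonFrmQuasiDefs
import Summits.CriticalPhenomena.PercolationContinuityZ3.Theorems.Transplant.SkelFrmQuasiBChoiceWindow
import Summits.CriticalPhenomena.PercolationContinuityZ3.Theorems.Transplant.SkelFrmBChoiceWindow
import Summits.CriticalPhenomena.PercolationContinuityZ3.Theorems.Transplant.SkelPhiCorridorKGBoxes
import Summits.CriticalPhenomena.PercolationContinuityZ3.Theorems.Transplant.SkelFrmQuasi1ChoiceDefs
import Summits.CriticalPhenomena.PercolationContinuityZ3.Theorems.Transplant.SkelFrmQuasi1ParamsLBL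
import Summits.CriticalPhenomena.PercolationContinuityZ3.Theorems.Transplant.SkelFrmQuasi1ParamsPO
import Summits.CriticalPhenomena.PercolationContinuityZ3.Theorems.Transplant.SkelFrmQuasiBChoiceNums
import Summits.CriticalPhenomena.PercolationContinuityZ3.Theorems.Transplant.SkelFrmQuasiBParamsCorrKG
import Summits.CriticalPhenomena.PercolationContinuityZ3.Theorems.Transplant.SkelFrmQuasiBParamsLF
import HarnessLib
import Summits.CriticalPhenomena.PercolationContinuityZ3.Theorems.Transplant.SkelFrmBChoiceReadNums
/-!
# GEN-Q PORT (WAVE-Q table v0.8 section 2, row G069, U-level L11; captain R-6/R-7 2026-08-27: carrier token swap `PlanarSkeletonFrmFrom ↦ PlanarSkeletonFrmQuasi`)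
# of the tree module «Transplant/SkelFrmFromBChoiceReadNums» (sha256 e42cfaca72965a50…) onto the quasi-step carrier `PlanarSkeletonFrmQuasi` (p507026): «SkelFrmQuasiBChoiceReadNums»

HAND HUNK (L-FLOORMAP-1 ① reader of G017): `KS0.R'0 κ Φ … ↦ KS0.R'0N κ Φ (KS.NQ Φ) …` (8 sites, statement of `valsQ_floor` included) and `KS0.T0_lt_R'0 ↦ KS0.T0N_lt_R'0N … (KS.one_le_NQ Φ)` (1).

ORIGINAL TITLE: N2 (frames-only node `SamePDropOfSkeletonFrm₁`, OPEN) — (ζ″) ledger, THE NUMBERS BEHIND THE (C) READING ROWS: at the tuple of record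

builds on p205010 (kernel theorem, internal audit signed; external expert review pending) — nothing in this file uses p205010; NOTHING is claimed about any open node
((N3-b), the end state).  Lane `prim-bschramm`, seat `prim-bschramm-stmt` (gen 33; GEN-Q column pen; tool = captain gen-1 g4's port_genq.py R-14 --cone + p3-g30's T1 patch).  Helper file (`--supports stmt-CriticalPhenomena-4575 --as helper`).
PORT RULES (U-wave r1–r4 re-used, GEN-Q hunk classes of p3-g29 #6136): declaration order, names and proof texts are those of «SkelFrmFromBChoiceReadNums», byte-identical except
(i) the carrier token `PlanarSkeletonFrmFrom ↦ PlanarSkeletonFrmQuasi` in binders, `namespace`/`end` lines and qualified names (module names `SkelFrmFrom… ↦ SkelFrmQuasi…`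
in imports of already-ported rows); (ii) `Φ.step ↦ Φ.qstep` with the called Steps lemma replaced by its `…Q`/`_q` twin and the cost `Φ.M` threaded (none in this file unless
listed below); (iii) `Φ.cyl_connected ↦ Φ.cyl_reach` readers (none unless listed); (iv) graph-ball radii / window floors ×`Φ.M` (none unless listed).  Carrier-free
residents stay imported/exported from the original «SkelFrmBChoiceReadNums» exactly as in the FrmFrom port.  Docstrings and citations are the original's.

-/

open scoped Classical

noncomputable section

namespace Summit.CriticalPhenomena.PercolationContinuityZ3.Theorems.Transplant

namespace Skelφ

/-! ## §1 Generic: `Z₀` as `X + R′ + 2n`, and a closed bound on `Z₁` -/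

section BoxesGeneric

variable {n ℓ : ℕ} {hs v : ℤ} {R' ρ q W : ℕ}

end BoxesGeneric

end Skelφ

/-! ## §2 At the tuple of record -/

namespace PlanarSkeletonFrmQuasi

namespace NegB

open Literature.Probability.Percolation Literature.Probability.LatticeModels SimpleGraph
open SkelConc (Consts)
open Skelφ (shearUnit kgSL kgΔ kgN kgFar kgX kgX₂ kgM₁ kgM₂ kgWm₂ kgWp₂ kgZ₀ kgZ₁ KGRows)
open TwoAxis.Para (modulus)
open Neg

section Vals

variable (κ : Consts) {V : Type} [DecidableEq V] [Countable V] {G : SimpleGraph V} [G.LocallyFinite] (Φ : PlanarSkeletonFrmQuasi G) (t : V) (p : unitInterval)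
  (D : Skelφ.StepI.DataNS V) (g f mk : ℕ)

/-- **The floor consequences at the tuple of record**: `40K·R′0 + 1 ≤ n_L`, `40K·R′0 ≤ sL + 1`, `958 ≤ sL`, `1 ≤ R′0`, `40 ≤ K`, `8R′0 + 7 ≤ n_L`. [folklore] -/
theorem valsQ_floor (κ : Consts) {V : Type} [DecidableEq V] [Countable V] {G : SimpleGraph V} [G.LocallyFinite] (Φ : PlanarSkeletonFrmQuasi G) (t : V) (p : unitInterval) (D : Skelφ.StepI.DataNS V) (g : ℕ) (f : ℕ) (mk : ℕ) (hN : EqNumL κ Φ t p D g f) (hg : gFloorKG κ Φ t p D mk ≤ g) (hg2 : 40 * Neg.K κ * KS0.R'0N κ Φ (KS.NQ Φ) t p D mk ≤ g) :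
    40 * (Neg.K κ : ℤ) * (KS0.R'0N κ Φ (KS.NQ Φ) t p D mk : ℕ) + 1 ≤ (nL κ Φ t p D g f : ℤ) ∧
    40 * (Neg.K κ : ℤ) * (KS0.R'0N κ Φ (KS.NQ Φ) t p D mk : ℕ) ≤ kgSL (nL κ Φ t p D g f) (ℓL κ Φ t p D g f) (hL κ Φ t p D g f) + 1 ∧
    958 ≤ kgSL (nL κ Φ t p D g f) (ℓL κ Φ t p D g f) (hL κ Φ t p D g f) ∧
    (1 : ℤ) ≤ (KS0.R'0N κ Φ (KS.NQ Φ) t p D mk : ℕ) ∧ (40 : ℤ) ≤ Neg.K κ ∧ 8 * ((KS0.R'0N κ Φ (KS.NQ Φ) t p D mk : ℕ) : ℤ) + 7 ≤ (nL κ Φ t p D g f : ℤ) := by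
  have hnle := hN.n_le
  have hgML : g ≤ ML κ Φ t p D g := (ML_le_ML κ Φ t p D g).2
  have hsL := ML_sub_one_le_kgSL κ Φ t p D g f hN
  have h960 := slack_floor_le_ML κ Φ t p D g
  have hM : (959 : ℤ) ≤ ML κ Φ t p D g := by
    have : 959 ≤ ML κ Φ t p D g := by omega
    exact_mod_cast this
  unfold gFloorKG at hg
  have hfl : ((8 * KS0.R'0N κ Φ (KS.NQ Φ) t p D mk + 3 * Mu D + 6 : ℕ) : ℤ) ≤ ML κ Φ t p D g := by exact_mod_cast hg.trans hgML
  have hfl2 : ((40 * Neg.K κ * KS0.R'0N κ Φ (KS.NQ Φ) t p D mk : ℕ) : ℤ) ≤ ML κ Φ t p D g := by exact_mod_cast hg2.trans hgML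
  push_cast at hfl hfl2
  have hR := (KS0.T0N_lt_R'0N κ Φ (KS.NQ Φ) t p D mk (KS.one_le_NQ Φ)).2.2.2
  have hR' : (1 : ℤ) ≤ (KS0.R'0N κ Φ (KS.NQ Φ) t p D mk : ℕ) := by exact_mod_cast hR
  have hK : (40 : ℤ) ≤ Neg.K κ := by exact_mod_cast (Neg.forty_le_K κ).1
  have hM0 : (0 : ℤ) ≤ (Mu D : ℤ) := by positivity
  refine ⟨by linarith, by linarith, by linarith, hR', hK, by linarith⟩

-- GEN-Q (R-2, captain 2026-08-27): `PlanarSkeletonFrmFrom.NegB.kgW_WxQ_eq` is not in the used cone of the node top — not ported.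

-- GEN-Q (R-2, captain 2026-08-27): `PlanarSkeletonFrmFrom.NegB.m₁Q_le` is not in the used cone of the node top — not ported.

-- GEN-Q (R-2, captain 2026-08-27): `PlanarSkeletonFrmFrom.NegB.X₂Q_le` is not in the used cone of the node top — not ported.

-- GEN-Q (R-2, captain 2026-08-27): `PlanarSkeletonFrmFrom.NegB.m₂Q_le` is not in the used cone of the node top — not ported.

-- GEN-Q (R-2, captain 2026-08-27): `PlanarSkeletonFrmFrom.NegB.Z₀Q_le` is not in the used cone of the node top — not ported.

-- GEN-Q (R-2, captain 2026-08-27): `PlanarSkeletonFrmFrom.NegB.Z₁Q_le` is not in the used cone of the node top — not ported.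

/-- **`U·sL ≤ Δ`** (`Δ = modulus n_L h_L v_L v_β > n_Lℓ_L − n_L ≥ sL·U − 1`). [folklore] -/
theorem UsL_le_modulus (κ : Consts) {V : Type} [DecidableEq V] [Countable V] {G : SimpleGraph V} [G.LocallyFinite] (Φ : PlanarSkeletonFrmQuasi G) (t : V) (p : unitInterval) (D : Skelφ.StepI.DataNS V) (g : ℕ) (f : ℕ) (hN : EqNumL κ Φ t p D g f) :
    ((shearUnit (nL κ Φ t p D g f) (hL κ Φ t p D g f) : ℕ) : ℤ) * kgSL (nL κ Φ t p D g f) (ℓL κ Φ t p D g f) (hL κ Φ t p D g f) ≤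
      modulus (nL κ Φ t p D g f) (hL κ Φ t p D g f) (vL κ Φ t p D g f) (vβL κ Φ t p D g f) := by
  obtain ⟨hn1, -⟩ := one_le_of_eqNumL κ Φ t p D g f hN
  have hm := (Skelφ.NegPrm.modulus_vβOf hn1 (hL κ Φ t p D g f) (ℓL κ Φ t p D g f) (vL κ Φ t p D g f)).1
  have hvβ : vβL κ Φ t p D g f = Skelφ.NegPrm.vβOf (nL κ Φ t p D g f) (hL κ Φ t p D g f) (ℓL κ Φ t p D g f) (vL κ Φ t p D g f) := rfl
  rw [hvβ]
  have hU : (0 : ℤ) < (shearUnit (nL κ Φ t p D g f) (hL κ Φ t p D g f) : ℕ) := Skelφ.shearUnit_pos hn1 _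
  have hUn : (nL κ Φ t p D g f : ℤ) ≤ (shearUnit (nL κ Φ t p D g f) (hL κ Φ t p D g f) : ℕ) := by
    rw [shearUnit_cast]; linarith [abs_nonneg (hL κ Φ t p D g f)]
  have hfl := Int.ediv_mul_le ((nL κ Φ t p D g f : ℤ) * ℓL κ Φ t p D g f - (shearUnit (nL κ Φ t p D g f) (hL κ Φ t p D g f) : ℕ) + 1) (ne_of_gt hU)
  have e : ((nL κ Φ t p D g f : ℤ) * ℓL κ Φ t p D g f - (shearUnit (nL κ Φ t p D g f) (hL κ Φ t p D g f) : ℕ) + 1) /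
      (shearUnit (nL κ Φ t p D g f) (hL κ Φ t p D g f) : ℕ) = kgSL (nL κ Φ t p D g f) (ℓL κ Φ t p D g f) (hL κ Φ t p D g f) := rfl
  rw [e] at hfl
  linarith

end Vals

end NegB

end PlanarSkeletonFrmQuasi

end Summit.CriticalPhenomena.PercolationContinuityZ3.Theorems.Transplant

end
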